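import Summits.HodgeConjecture.HodgeConjecture.Theorems.HeckePrymWeilHeckePrymAnchorsOfSections
import Summits.HodgeConjecture.HodgeConjecture.Theorems.HeckePrymWeilHeckePrymAnchorsGlobalClassOfLeray
import Literature.AlgebraicGeometry.HodgeTheory.InvariantClassesFromTotalSpace
import Literature.AlgebraicGeometry.HodgeTheory.WeilFamilyFlatSections
import HarnessLib

/-!
# `HeckePrymAnchors` modulo two named facts of the tree: Deligne 1968 and Deligne's Weil family (item stmt-HodgeConjecture-14496, route HeckePrymWeil)

Line `Sketch`, v6 (continuation lead c2): the crux `HeckePrymAnchors` of route `HeckePrymWeil`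
derived from exactly TWO published theorems, both recorded as named facts of the tree and taken as
hypotheses (the result is CONDITIONAL on them and on nothing else):

* `hL : HodgeTheory.deligne1968_invariantClass_fromTotalSpace` — Deligne 1968, Prop. (2.1) with
  (2.6.3) = Voisin, *Hodge Theory II*, Thm. 4.18 (with 4.15, 4.17): for a projective submersion the
  Leray spectral sequence degenerates, so every monodromy-invariant class of a fibre (every value of a
  continuous section of the espace étalé of `Rᵏ f_* ℂ`) is the restriction of a class of the OPEN total
  space;
* `hWF : HodgeTheory.deligne1982_weilFamily_hodgeWeilSection` — Deligne, LNM 900 I, proof of Thm. 4.8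
  (pp. 47–52) with clause (a) and Prop. 4.4; van Geemen LNM 1594 §5.3–5.11; André 1996 Lemme 6.3.3:
  the polarized `ℚ(√-p)`-Weil family through `X` (embedded smooth projective family over a smooth
  quasi-projective irreducible base, every fibre a `√-p`-abelian `2k`-fold of Weil type) with a flat
  Weil section through `c` that is of Hodge type `(k,k)` at every fibre, and a fibre `K`-isogenous to a
  tensor point `(A₁ × A₁, companion)` at which the section lies in the strong Weil plane.

Compared with the accepted v4 result `heckePrymAnchors_of_facts` (four facts: partie fixe Hodge II
4.1.1, Hironaka, Charles–Schnell 11.3.5 (1), Weil family), the partie fixe is replaced by the input of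
its own printed proof (no mixed Hodge theory), Hironaka's compactification is gone (the W-engine works
on the open total space), and Charles–Schnell 11.3.5 (1) is replaced by clause (a) of Deligne's own
family. Everything else is PROVED in the tree: `heckePrymAnchors_of_sections` (composition),
`stub_globalClassOfSection_of_leray` (W-engine: Deligne 1968 at one point + the identity principle for
continuous sections over the connected base, Ehresmann), `stub_weilSurface`, `stub_upgrade`,
`stub_rationalAlongSection`, `owf_anchored_zero`, `owf_anchorAlgebraic` (Deligne's tensor-point anchor
across the isogeny pair), `owf_isoTransport` (the route's proved `IsoInvariance`).

The three-fact variant (Deligne 1968 + Charles–Schnell 11.3.5 (1) + the v4 Weil-family package) is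
`heckePrymAnchors_of_three_facts` (`…HeckePrymAnchorsOfThreeFacts`). No definition, no `sorry`.
-/

noncomputable section

-- every declaration of this problem lives in `Summit.HodgeConjecture.HodgeConjecture.…` (summit = sub-problem)
set_option linter.dupNamespace false

open CategoryTheory AlgebraicGeometry Limits MonoidalCategory CartesianMonoidalCategory

namespace Summit.HodgeConjecture.HodgeConjecture.Theorems.HeckePrymWeilLine

open Literature.AlgebraicGeometry Literature.AlgebraicGeometry.Motives Literature.AlgebraicGeometry.HodgeTheory
open Summit.HodgeConjecture.HodgeConjecture.Theses.HeckePrymWeil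

/-- **`HeckePrymAnchors` from two named facts of the tree** (CONDITIONAL result): Deligne 1968 /
Voisin II Thm. 4.18 `deligne1968_invariantClass_fromTotalSpace` and Deligne's Weil family with a flat,
fibrewise Hodge, Weil section and a tensor-split fibre `deligne1982_weilFamily_hodgeWeilSection`
together imply the crux: the landed composition `heckePrymAnchors_of_sections` fed by the landed
W-engine `stub_globalClassOfSection_of_leray hL` and by `hWF`. For the rational `(k,k)` class `c ≠ 0`
of the typed Weil plane of `(A × B, φ × ψ)`, `B = E × E` the companion surface: upgrade `c` to the
strong Weil plane, take the Weil family `f : 𝒳 → S` through `A × B` with its flat section `σ` through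
`c` (`hWF`), globalise `σ` to ONE class `W ∈ H^{2k}(𝒳(ℂ); ℂ)` of the open total space (`hL` at one
point + identity principle), read rationality of `W|_{𝒳_s}` from flat transport and Hodge type `(k,k)`
from clause (a) of the family, and algebraicity of `W` at the tensor-split fibre from Deligne's
tensor-point anchor across the isogeny pair and the fibre isomorphism; `c = 0` is anchored by the
constant family. [cite: Deligne1968, Prop. (2.1) with (2.6.3)] [cite: VoisinHodgeII2003, Thm. 4.18]
[cite: Deligne1982HodgeCycles, proof of Thm. 4.8 (pp. 47–52) with (a), Prop. 4.4, Lemma 4.5, Remark 4.10]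
[cite: vanGeemen1994HodgeAV, §5.3–5.11] [cite: Andre1996Motifs, Lemme 6.3.3] -/
theorem heckePrymAnchors_of_two_facts :
    (deligne1968_invariantClass_fromTotalSpace) → (deligne1982_weilFamily_hodgeWeilSection) → Summit.HodgeConjecture.HodgeConjecture.Theses.HeckePrymWeil.HeckePrymAnchors :=
  fun hL hWF => heckePrymAnchors_of_sections (stub_globalClassOfSection_of_leray hL) hWF

end Summit.HodgeConjecture.HodgeConjecture.Theorems.HeckePrymWeilLine

end
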